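import Summits.ResolutionOfSingularities.ResolutionOfSingularities.Theorems.WeightedInvariantIota3Eps
import Summits.ResolutionOfSingularities.ResolutionOfSingularities.Theorems.WeightedInvariantContactCylinderStratumMap
import Literature.AlgebraicGeometry.Resolution.RegularLocalRingsFlatDescent
import Literature.AlgebraicGeometry.Resolution.SmoothUniformizationProofs
import Literature.AlgebraicGeometry.Resolution.ReducedOfSmoothOverReduced
import HarnessLib

/-!
# (c11) for the letter `ε`: the permissibility of the equimultiple locus is COMPATIBLE WITH ESSENTIALLY SMOOTH LOCAL
# HOMOMORPHISMS — `iotaEps S′ (φ f) = iotaEps S f`, in every dimension — door `HypersurfaceCentreConstruction`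
# (stmt-ResolutionOfSingularities-19897), route `WeightedInvariant`, rung P3, ORDER (o32-ι-a″)

[OURS · L1 W4.3 · cell `res-hironaka`, HUMAN RULING D-0089] Helper file `--supports stmt-ResolutionOfSingularities-19897`,
res-type-013 on res-L1-w43-plan-1's IOTA3-DESIGN v1 (`L/res-L1-w43-plan-1/IOTA3-DESIGN.md` 75648d6c57caba4d, §2.2 lemma obligation
(c11ε|ν), ORDER (o32-ι-a″), DEALS gen 10 #8 (2), HOME/STATUS 2026-08-27T11:27:10Z).  Def-free; pure commutative algebra over the tree;
no named facts.  NOT a statement of the manuscript under review (Hironaka 2017, [claim: Hironaka2017, status: under-review]); nothing here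
claims anything about resolution of singularities; AI work, weaker than expert review.

SETTING (the `ι`-binder block of `IotaJEssSmoothCompatible`, …HypersurfaceLocalGameEFT3): `φ : S → S′` a LOCAL homomorphism of REGULAR
local rings which is FORMALLY SMOOTH and ESSENTIALLY OF FINITE TYPE; `f ∈ S`.  By res-D-brk-1's `ContactCylinder.topStratum_iotaOrd_map`
(p526917) the equimultiple locus is compatible with `φ`: `Σ(S′, φ f) = (Spec φ)⁻¹ Σ(S, f)`.  This file adds the PERMISSIBILITY letter:

* §1 the quotient base change `S ⧸ P → S′ ⧸ P S′` (flat, local, essentially smooth; its closed fibre is that of `φ`);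
* §2 ASCENT `isPermissibleEquimultipleLocus_map`: `Σ(S) = V(P)` with `S ⧸ P` regular ⇒ `S′ ⧸ P S′` is regular (Matsumura 23.7 with the
  regular closed fibre `S′ ⧸ 𝔪_S S′`, tree `isRegularLocalRing_iff_of_flat_of_isRegularLocalRing_fibre`), hence `P S′` is prime and
  `Σ(S′) = V(P S′)` is a permissible centre;
* §3 DESCENT `isPermissibleEquimultipleLocus_of_map`: `Σ(S′) = V(P′)` with `S′ ⧸ P′` regular ⇒ with `P = P′ ∩ S`: `Σ(S) = V(P)` (`P = π(P′) ∈ Σ(S)`,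
  `Σ` is closed under specialisation by (c7), and `Spec φ` is surjective by faithful flatness); `P′` is the unique minimal prime of `P S′`
  (going down) and `S′ ⧸ P S′` is REDUCED (flat over the domain `S ⧸ P` with generic fibre essentially smooth over a field, tree
  `isReduced_of_flat_of_isReduced_tensor`), so `P S′ = P′`, and `S ⧸ P → S′ ⧸ P′` is flat local with regular target, whence `S ⧸ P` is
  regular (Matsumura 23.7 (i), tree `IsRegularLocalRing.of_flat_of_isLocalHom`);
* §4 **`iotaEps_essSmooth_eq`**, **`iotaOrdEps_essSmooth_eq`** — (c11ε) and (c11) ι-half for the pair `(ν ; ε)`, dimension-free.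

## References

* H. Matsumura, *Commutative Ring Theory*, CUP 1986, Thm. 23.7 (regularity along flat local maps), Thm. 9.5 (going down for flat
  extensions), §7 (flat ⇒ torsion-free). [Matsumura1987]
* A. Grothendieck, EGA IV₄, Prop. 17.5.8 (iii) (smooth ⇒ regular fibres). [Grothendieck1967]
* res-L1-w43-plan-1, `IOTA3-DESIGN.md` v1 §2.2 (OURS, AI planning); res-type-078, `IOTA3-INPUT.md` v1.1 §2 row (c11) (OURS).
-/

noncomputable section

set_option linter.dupNamespace false -- mandated namespace `Summit.<Summit>.<Problem>` of this single-conjunct summit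

open IsLocalRing Literature.AlgebraicGeometry.Resolution
open scoped TensorProduct
open Summit.ResolutionOfSingularities.ResolutionOfSingularities.Theorems (ContactCylinder.topStratum)
open Summit.ResolutionOfSingularities.ResolutionOfSingularities.Theorems.ContactCylinder

namespace Summit.ResolutionOfSingularities.ResolutionOfSingularities.Cruxes.HypersurfaceCentreConstruction.LocalEngine

namespace Iota3

/-! ## §0 The equimultiple locus is closed under specialisation (from (c7) for the order function) -/

section Specialisation

variable {S : Type} [CommRing S] [IsRegularLocalRing S]

/-- The order of `f` at a prime `𝔮 ≤ 𝔭` is at most its order at `𝔭` (`S_𝔮` is a localisation of the regular local ring `S_𝔭`;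
(c7) `iotaOrd_generizationMonotone`). [cite: Matsumura1987, §5] -/
theorem iotaOrd_localization_le_of_le (f : S) {𝔮 𝔭 : Ideal S} [𝔮.IsPrime] [𝔭.IsPrime] (hle : 𝔮 ≤ 𝔭) :
    iotaOrd (Localization.AtPrime 𝔮) (algebraMap S (Localization.AtPrime 𝔮) f) ≤
      iotaOrd (Localization.AtPrime 𝔭) (algebraMap S (Localization.AtPrime 𝔭) f) := by
  -- `𝔮 S_𝔭` is a prime of `S_𝔭` contracting to `𝔮`
  have hdisj : Disjoint (𝔭.primeCompl : Set S) (𝔮 : Set S) := Set.disjoint_left.mpr fun s hs hs𝔮 => hs (hle hs𝔮)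
  set 𝔮' : Ideal (Localization.AtPrime 𝔭) := 𝔮.map (algebraMap S (Localization.AtPrime 𝔭)) with h𝔮'
  haveI h𝔮'p : 𝔮'.IsPrime := IsLocalization.isPrime_of_isPrime_disjoint 𝔭.primeCompl _ 𝔮 ‹_› hdisj
  have hunder : 𝔮'.comap (algebraMap S (Localization.AtPrime 𝔭)) = 𝔮 :=
    IsLocalization.under_map_of_isPrime_disjoint 𝔭.primeCompl (Localization.AtPrime 𝔭) ‹𝔮.IsPrime› hdisj
  -- `(S_𝔭)_{𝔮'} ≃ S_𝔮` over `S`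
  let e : Localization.AtPrime (𝔮'.comap (algebraMap S (Localization.AtPrime 𝔭))) ≃ₐ[S] Localization.AtPrime 𝔮' :=
    IsLocalization.localizationLocalizationAtPrimeIsoLocalization 𝔭.primeCompl 𝔮'
  haveI : IsRegularLocalRing (Localization.AtPrime 𝔭) := isRegularLocalRing_localization_atPrime S 𝔭
  -- (c7) at the regular local ring `S_𝔭` and its prime `𝔮'`
  have hmono := iotaOrd_generizationMonotone (Localization.AtPrime 𝔭) 𝔮' (algebraMap S (Localization.AtPrime 𝔭) f)
  have h1 : algebraMap (Localization.AtPrime 𝔭) (Localization.AtPrime 𝔮') (algebraMap S (Localization.AtPrime 𝔭) f) =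
      algebraMap S (Localization.AtPrime 𝔮') f := (IsScalarTower.algebraMap_apply S _ _ f).symm
  have h2 : e (algebraMap S (Localization.AtPrime (𝔮'.comap (algebraMap S (Localization.AtPrime 𝔭)))) f) =
      algebraMap S (Localization.AtPrime 𝔮') f := e.commutes f
  have h2' : iotaOrd (Localization.AtPrime 𝔮')
      (e (algebraMap S (Localization.AtPrime (𝔮'.comap (algebraMap S (Localization.AtPrime 𝔭)))) f)) =
      iotaOrd (Localization.AtPrime (𝔮'.comap (algebraMap S (Localization.AtPrime 𝔭))))
        (algebraMap S (Localization.AtPrime (𝔮'.comap (algebraMap S (Localization.AtPrime 𝔭)))) f) :=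
    iotaOrd_isoInvariant _ _ e.toRingEquiv _
  rw [h1, ← h2, h2'] at hmono
  -- rewrite the contracted prime as `𝔮`
  have key : ∀ (X : Ideal S) [X.IsPrime], X = 𝔮 →
      iotaOrd (Localization.AtPrime X) (algebraMap S (Localization.AtPrime X) f) =
        iotaOrd (Localization.AtPrime 𝔮) (algebraMap S (Localization.AtPrime 𝔮) f) := by
    rintro X _ rfl
    rfl
  rw [key _ hunder] at hmono
  exact hmono

/-- **The equimultiple locus of a regular local ring is closed under specialisation**: if `𝔮 ∈ Σ(S, f)` and `𝔮 ≤ 𝔭` then `𝔭 ∈ Σ(S, f)`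
(`ord_S f = ord_{S_𝔮} f ≤ ord_{S_𝔭} f ≤ ord_S f`). [cite: Matsumura1987, §5] -/
theorem mem_topStratum_iotaOrd_of_le (f : S) {𝔮 𝔭 : PrimeSpectrum S} (hle : 𝔮.asIdeal ≤ 𝔭.asIdeal)
    (h𝔮 : 𝔮 ∈ topStratum iotaOrd S f) : 𝔭 ∈ topStratum iotaOrd S f := by
  rw [Theorems.ContactCylinder.mem_topStratum_iff] at h𝔮 ⊢
  refine le_antisymm (iotaOrd_generizationMonotone S 𝔭.asIdeal f) ?_
  rw [← h𝔮]
  exact iotaOrd_localization_le_of_le f hle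

end Specialisation

/-! ## §1 The quotient base change `S ⧸ P → S′ ⧸ P S′` -/

section QuotientBaseChange

variable (S S' : Type) [CommRing S] [CommRing S'] [IsLocalRing S] [IsLocalRing S'] [Algebra S S']
  [IsLocalHom (algebraMap S S')] (P : Ideal S) [P.IsPrime]

/-- `P S′ ≠ ⊤` (it lies in `𝔪_S S′ ≤ 𝔪_{S′}`). [folklore] -/
theorem map_ne_top_of_isPrime : P.map (algebraMap S S') ≠ ⊤ := by
  intro htop
  have hle : P.map (algebraMap S S') ≤ maximalIdeal S' :=
    (Ideal.map_mono (IsLocalRing.le_maximalIdeal (Ideal.IsPrime.ne_top ‹_›))).trans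
      (((IsLocalRing.local_hom_TFAE (algebraMap S S')).out 0 2).mp ‹_›)
  rw [htop] at hle
  exact (IsLocalRing.maximalIdeal.isMaximal S').ne_top (top_le_iff.mp hle)

/-- `S′ ⧸ P S′` is non-trivial. [folklore] -/
theorem nontrivial_quotient_map : Nontrivial (S' ⧸ P.map (algebraMap S S')) :=
  Ideal.Quotient.nontrivial_iff.mpr (map_ne_top_of_isPrime S S' P)

/-- `S′ ⧸ P S′` is a local ring. [folklore] -/
theorem isLocalRing_quotient_map : IsLocalRing (S' ⧸ P.map (algebraMap S S')) :=
  haveI := nontrivial_quotient_map S S' P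
  IsLocalRing.of_surjective' (Ideal.Quotient.mk _) Ideal.Quotient.mk_surjective

/-- `S ⧸ P` is a local ring. [folklore] -/
theorem isLocalRing_quotient : IsLocalRing (S ⧸ P) :=
  IsLocalRing.of_surjective' (Ideal.Quotient.mk _) Ideal.Quotient.mk_surjective

/-- The induced map `S ⧸ P → S′ ⧸ P S′` is a LOCAL homomorphism. [folklore] -/
theorem isLocalHom_quotient_map :
    haveI := isLocalRing_quotient S P
    haveI := isLocalRing_quotient_map S S' P
    IsLocalHom (algebraMap (S ⧸ P) (S' ⧸ P.map (algebraMap S S'))) := by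
  haveI := isLocalRing_quotient S P
  haveI := isLocalRing_quotient_map S S' P
  haveI := nontrivial_quotient_map S S' P
  refine ⟨fun a ha => ?_⟩
  obtain ⟨x, rfl⟩ := Ideal.Quotient.mk_surjective a
  rw [Ideal.Quotient.algebraMap_quotient_map_quotient] at ha
  -- `φ x` is a unit of `S′` (units lift along the local surjection `S′ → S′ ⧸ P S′`), hence `x` is a unit of `S`
  have hu : IsUnit (algebraMap S S' x) := by
    by_contra hnu
    have hmem : algebraMap S S' x ∈ maximalIdeal S' := (IsLocalRing.mem_maximalIdeal _).mpr (mem_nonunits_iff.mpr hnu)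
    have hmem' : Ideal.Quotient.mk (P.map (algebraMap S S')) (algebraMap S S' x) ∈
        maximalIdeal (S' ⧸ P.map (algebraMap S S')) := by
      rw [maximalIdeal_quotient_eq_map]
      exact Ideal.mem_map_of_mem _ hmem
    exact (mem_nonunits_iff.mp ((IsLocalRing.mem_maximalIdeal _).mp hmem')) ha
  have hx : IsUnit x := (isUnit_map_iff (algebraMap S S') x).mp hu
  exact hx.map (Ideal.Quotient.mk P)

omit [IsLocalRing S] [IsLocalRing S'] [IsLocalHom (algebraMap S S')] [P.IsPrime] in
/-- `S′ ⧸ P S′` is FLAT over `S ⧸ P` when `S′` is flat over `S` (it is the base change `(S ⧸ P) ⊗_S S′`). [folklore] -/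
theorem flat_quotient_map [Module.Flat S S'] : Module.Flat (S ⧸ P) (S' ⧸ P.map (algebraMap S S')) :=
  Module.Flat.of_linearEquiv (Algebra.TensorProduct.quotIdealMapEquivQuotTensor S' P).toLinearEquiv

omit [IsLocalRing S] [IsLocalRing S'] [IsLocalHom (algebraMap S S')] [P.IsPrime] in
/-- `S′ ⧸ P S′` is FORMALLY SMOOTH over `S ⧸ P` when `S′` is formally smooth over `S`. [folklore] -/
theorem formallySmooth_quotient_map [Algebra.FormallySmooth S S'] :
    Algebra.FormallySmooth (S ⧸ P) (S' ⧸ P.map (algebraMap S S')) :=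
  Algebra.FormallySmooth.of_equiv (Algebra.TensorProduct.quotIdealMapEquivQuotTensor S' P).symm

omit [IsLocalRing S] [IsLocalRing S'] [IsLocalHom (algebraMap S S')] [P.IsPrime] in
/-- `S′ ⧸ P S′` is ESSENTIALLY OF FINITE TYPE over `S ⧸ P` when `S′` is so over `S`. [folklore] -/
theorem essFiniteType_quotient_map [Algebra.EssFiniteType S S'] :
    Algebra.EssFiniteType (S ⧸ P) (S' ⧸ P.map (algebraMap S S')) :=
  Algebra.EssFiniteType.of_comp S (S ⧸ P) (S' ⧸ P.map (algebraMap S S'))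

omit [IsLocalRing S'] [IsLocalHom (algebraMap S S')] in
/-- THE CLOSED FIBRE of `S ⧸ P → S′ ⧸ P S′` is the closed fibre `S′ ⧸ 𝔪_S S′` of `φ` (stated as the existence of a ring isomorphism,
to keep the file definition-free). [folklore] -/
theorem nonempty_quotientMapFibreEquiv :
    haveI := isLocalRing_quotient S P
    Nonempty ((S' ⧸ P.map (algebraMap S S')) ⧸ (maximalIdeal (S ⧸ P)).map (algebraMap (S ⧸ P) (S' ⧸ P.map (algebraMap S S'))) ≃+*
      S' ⧸ (maximalIdeal S).map (algebraMap S S')) := by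
  haveI := isLocalRing_quotient S P
  refine ⟨?_⟩
  have hmax : (maximalIdeal (S ⧸ P)).map (algebraMap (S ⧸ P) (S' ⧸ P.map (algebraMap S S'))) =
      ((maximalIdeal S).map (algebraMap S S')).map (Ideal.Quotient.mk (P.map (algebraMap S S'))) := by
    rw [maximalIdeal_quotient_eq_map, Ideal.map_map, Ideal.map_map]
    congr 1
  have hsup : P.map (algebraMap S S') ⊔ (maximalIdeal S).map (algebraMap S S') = (maximalIdeal S).map (algebraMap S S') :=
    sup_eq_right.mpr (Ideal.map_mono (IsLocalRing.le_maximalIdeal (Ideal.IsPrime.ne_top ‹_›)))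
  exact ((Ideal.quotEquivOfEq hmax).trans (DoubleQuot.quotQuotEquivQuotSup _ _)).trans (Ideal.quotEquivOfEq hsup)

end QuotientBaseChange

/-! ## §2 ASCENT -/

section EssSmooth

variable (S S' : Type) [CommRing S] [CommRing S'] [IsRegularLocalRing S] [IsRegularLocalRing S'] [Algebra S S']
  [IsLocalHom (algebraMap S S')] [Algebra.FormallySmooth S S'] [Algebra.EssFiniteType S S']

/-- **ASCENT OF REGULARITY ALONG THE CENTRE** (Matsumura 23.7 with regular closed fibre): if `S ⧸ P` is regular then so is `S′ ⧸ P S′` —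
the map `S ⧸ P → S′ ⧸ P S′` is flat and local, and its closed fibre `S′ ⧸ 𝔪_S S′` is regular (res-type-070's
`IotaOrderEssSmooth.isRegularLocalRing_fibre_of_formallySmooth`). [cite: Matsumura1987, Thm. 23.7 (ii)] -/
theorem isRegularLocalRing_quotient_map_of_isRegularLocalRing_quotient (P : Ideal S) [P.IsPrime] (hreg : IsRegularLocalRing (S ⧸ P)) :
    IsRegularLocalRing (S' ⧸ P.map (algebraMap S S')) := by
  haveI := hreg
  haveI := isLocalRing_quotient_map S S' P
  haveI := isLocalHom_quotient_map S S' P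
  haveI : Module.Flat S S' := IotaOrderEssSmooth.flat_of_formallySmooth_of_essFiniteType S S'
  haveI := flat_quotient_map S S' P
  haveI : IsNoetherianRing (S' ⧸ P.map (algebraMap S S')) := inferInstance
  haveI hfib : IsRegularLocalRing
      ((S' ⧸ P.map (algebraMap S S')) ⧸ (maximalIdeal (S ⧸ P)).map (algebraMap (S ⧸ P) (S' ⧸ P.map (algebraMap S S')))) :=
    haveI := IotaOrderEssSmooth.isRegularLocalRing_fibre_of_formallySmooth S S'
    IsRegularLocalRing.of_ringEquiv (Classical.choice (nonempty_quotientMapFibreEquiv S S' P)).symm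
  exact (isRegularLocalRing_iff_of_flat_of_isRegularLocalRing_fibre (R := S ⧸ P) (S := S' ⧸ P.map (algebraMap S S'))).mpr hreg

/-- … hence `P S′` is PRIME. [cite: Matsumura1987, Thm. 23.7 (ii)] -/
theorem isPrime_map_of_isRegularLocalRing_quotient (P : Ideal S) [P.IsPrime] (hreg : IsRegularLocalRing (S ⧸ P)) :
    (P.map (algebraMap S S')).IsPrime := by
  haveI := isRegularLocalRing_quotient_map_of_isRegularLocalRing_quotient S S' P hreg
  haveI := isDomain_of_isRegularLocalRing (S' ⧸ P.map (algebraMap S S'))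
  exact (Ideal.Quotient.isDomain_iff_prime _).mp inferInstance

/-- **ASCENT**: if the equimultiple locus of `(S, f)` is a permissible centre, so is that of `(S′, φ f)` (centre `V(P) ↦ V(P S′)`).
[OURS · L1 W4.3, kernel] -/
theorem isPermissibleEquimultipleLocus_map (f : S) (h : IsPermissibleEquimultipleLocus S f) :
    IsPermissibleEquimultipleLocus S' (algebraMap S S' f) := by
  obtain ⟨P, hP, hreg, hS⟩ := h
  haveI := isPrime_map_of_isRegularLocalRing_quotient S S' P hreg
  exact ⟨P.map (algebraMap S S'), inferInstance, isRegularLocalRing_quotient_map_of_isRegularLocalRing_quotient S S' P hreg,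
    topStratum_iotaOrd_map_of_eq S S' f hS⟩

/-! ## §3 DESCENT -/

/-- A ring that is formally smooth and essentially of finite type over a FIELD is reduced (all its local rings are regular:
tree `isRegularLocalRing_of_formallySmooth_of_essFiniteType`). [cite: Grothendieck1967, Prop. 17.5.8 (iii)] -/
theorem isReduced_of_formallySmooth_of_essFiniteType_field (K T : Type) [Field K] [CommRing T] [Algebra K T]
    [Algebra.FormallySmooth K T] [Algebra.EssFiniteType K T] : IsReduced T := by
  refine isReduced_ofLocalizationMaximal T fun J hJ => ?_
  haveI := hJ
  haveI : IsRegularLocalRing (Localization.AtPrime J) := isRegularLocalRing_of_formallySmooth_of_essFiniteType K _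
  haveI := isDomain_of_isRegularLocalRing (Localization.AtPrime J)
  infer_instance

omit [IsLocalHom (algebraMap S S')] in
/-- `S′ ⧸ P S′` is REDUCED for every prime `P` of `S`: it is flat over the domain `S ⧸ P`, whose only minimal prime is `⊥`, and its generic
fibre `Frac(S ⧸ P) ⊗ (S′ ⧸ P S′)` is formally smooth and essentially of finite type over a field (tree `isReduced_of_flat_of_isReduced_tensor`).
[cite: Matsumura1987, §7; Grothendieck1967, Prop. 17.5.8 (iii)] -/
theorem isReduced_quotient_map (P : Ideal S) [P.IsPrime] : IsReduced (S' ⧸ P.map (algebraMap S S')) := by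
  haveI : Module.Flat S S' := IotaOrderEssSmooth.flat_of_formallySmooth_of_essFiniteType S S'
  haveI := flat_quotient_map S S' P
  haveI := formallySmooth_quotient_map S S' P
  haveI := essFiniteType_quotient_map S S' P
  refine isReduced_of_flat_of_isReduced_tensor (S ⧸ P) (S' ⧸ P.map (algebraMap S S')) fun p => ?_
  -- the minimal prime `p` of the domain `S ⧸ P` is `⊥`, so `Frac((S ⧸ P) ⧸ p)` is a field over which the fibre is essentially smooth
  have hp : (p.1 : Ideal (S ⧸ P)) = ⊥ := by
    have hmin : (p.1 : Ideal (S ⧸ P)) ∈ Ideal.minimalPrimes (⊥ : Ideal (S ⧸ P)) := p.2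
    rw [Ideal.minimalPrimes_eq_subsingleton_self] at hmin
    exact Set.mem_singleton_iff.mp hmin
  haveI : (p.1 : Ideal (S ⧸ P)).IsPrime := p.2.1.1
  haveI : IsDomain ((S ⧸ P) ⧸ (p.1 : Ideal (S ⧸ P))) := (Ideal.Quotient.isDomain_iff_prime _).mpr inferInstance
  set K := FractionRing ((S ⧸ P) ⧸ (p.1 : Ideal (S ⧸ P)))
  haveI : IsReduced (K ⊗[S ⧸ P] (S' ⧸ P.map (algebraMap S S'))) :=
    isReduced_of_formallySmooth_of_essFiniteType_field K _
  exact isReduced_of_injective (Algebra.TensorProduct.comm (S ⧸ P) (S' ⧸ P.map (algebraMap S S')) K).toRingHom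
    (Algebra.TensorProduct.comm (S ⧸ P) (S' ⧸ P.map (algebraMap S S')) K).injective

/-- **DESCENT**: if the equimultiple locus of `(S′, φ f)` is a permissible centre `V(P′)`, then that of `(S, f)` is the permissible centre
`V(P′ ∩ S)`. [OURS · L1 W4.3, kernel] -/
theorem isPermissibleEquimultipleLocus_of_map (f : S) (h : IsPermissibleEquimultipleLocus S' (algebraMap S S' f)) :
    IsPermissibleEquimultipleLocus S f := by
  obtain ⟨P', hP', hreg', hS'⟩ := h
  haveI : Module.Flat S S' := IotaOrderEssSmooth.flat_of_formallySmooth_of_essFiniteType S S'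
  haveI : Module.FaithfullyFlat S S' := Module.FaithfullyFlat.of_flat_of_isLocalHom
  set P : Ideal S := P'.comap (algebraMap S S') with hPdef
  haveI hP : P.IsPrime := Ideal.comap_isPrime _ _
  -- `P ∈ Σ(S)`: it is the image of `P′ ∈ Σ(S′)`
  have hPmem : (⟨P, hP⟩ : PrimeSpectrum S) ∈ topStratum iotaOrd S f := by
    have h' : (⟨P', hP'⟩ : PrimeSpectrum S') ∈ topStratum iotaOrd S' (algebraMap S S' f) := by
      rw [hS']; exact (le_rfl : P' ≤ P')
    exact (mem_topStratum_iotaOrd_map_iff S S' f ⟨P', hP'⟩).mp h'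
  -- (i) `Σ(S) = V(P)`
  have hS : topStratum iotaOrd S f = {𝔮 | P ≤ 𝔮.asIdeal} := by
    ext 𝔮
    constructor
    · intro h𝔮
      -- lift `𝔮` to a prime `𝔮′` of `S′` (faithful flatness); it lies in `Σ(S′) = V(P′)`
      obtain ⟨𝔮', h𝔮'⟩ := PrimeSpectrum.comap_surjective_of_faithfullyFlat (A := S) (B := S') 𝔮
      have hmem' : 𝔮' ∈ topStratum iotaOrd S' (algebraMap S S' f) := by
        rw [mem_topStratum_iotaOrd_map_iff S S' f 𝔮', h𝔮']; exact h𝔮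
      rw [hS'] at hmem'
      change P ≤ 𝔮.asIdeal
      rw [← h𝔮']
      exact Ideal.comap_mono hmem'
    · intro hle
      exact mem_topStratum_iotaOrd_of_le f (𝔮 := ⟨P, hP⟩) (𝔭 := 𝔮) hle hPmem
  -- (ii) `P′` is the unique minimal prime of `P S′`
  have hPS' : P.map (algebraMap S S') ≤ P' := Ideal.map_le_iff_le_comap.mpr le_rfl
  have hmin : ∀ 𝔮' ∈ (P.map (algebraMap S S')).minimalPrimes, 𝔮' = P' := by
    intro 𝔮' h𝔮'
    haveI h𝔮'p : 𝔮'.IsPrime := h𝔮'.1.1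
    have h𝔮'ge : P.map (algebraMap S S') ≤ 𝔮' := h𝔮'.1.2
    -- `𝔮′ ∩ S = P` by going down
    have hunder : 𝔮'.comap (algebraMap S S') = P := by
      have hge : P ≤ 𝔮'.comap (algebraMap S S') := Ideal.map_le_iff_le_comap.mp h𝔮'ge
      by_contra hne
      have hlt : P < 𝔮'.comap (algebraMap S S') := lt_of_le_of_ne hge (Ne.symm hne)
      haveI : 𝔮'.LiesOver (𝔮'.comap (algebraMap S S')) := ⟨rfl⟩
      obtain ⟨Q, hQlt, hQp, hQover⟩ := Ideal.exists_ideal_lt_liesOver_of_lt (p := P) 𝔮' hlt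
      have hQge : P.map (algebraMap S S') ≤ Q := by
        rw [Ideal.map_le_iff_le_comap, ← Ideal.under_def, ← hQover.over]
      exact absurd (h𝔮'.2 ⟨hQp, hQge⟩ hQlt.le) (not_le_of_gt hQlt)
    -- hence `𝔮′ ∈ Σ(S′) = V(P′)`, so `P′ ≤ 𝔮′`, and minimality gives equality
    have hmem𝔮' : (⟨𝔮', h𝔮'p⟩ : PrimeSpectrum S') ∈ topStratum iotaOrd S' (algebraMap S S' f) := by
      rw [mem_topStratum_iotaOrd_map_iff S S' f]
      have : PrimeSpectrum.comap (algebraMap S S') ⟨𝔮', h𝔮'p⟩ = ⟨P, hP⟩ := PrimeSpectrum.ext hunder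
      rw [this]; exact hPmem
    rw [hS'] at hmem𝔮'
    exact le_antisymm (h𝔮'.2 ⟨hP', hPS'⟩ hmem𝔮') hmem𝔮'
  have hrad : (P.map (algebraMap S S')).radical = P' := by
    rw [← Ideal.sInf_minimalPrimes]
    obtain ⟨p, hp, -⟩ := Ideal.exists_minimalPrimes_le hPS'
    have hp' : p = P' := hmin p hp
    apply le_antisymm
    · exact sInf_le (hp' ▸ hp)
    · exact le_sInf fun q hq => (hmin q hq).symm.le
  -- `S′ ⧸ P S′` is reduced, so `P S′ = P′`
  have heq : P.map (algebraMap S S') = P' := by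
    rw [← hrad]
    exact ((Ideal.isRadical_iff_quotient_reduced _).mpr (isReduced_quotient_map S S' P)).radical.symm
  -- (iii) `S ⧸ P` is regular by flat descent from `S′ ⧸ P′ = S′ ⧸ P S′`
  haveI := isLocalRing_quotient S P
  haveI := isLocalRing_quotient_map S S' P
  haveI := isLocalHom_quotient_map S S' P
  haveI := flat_quotient_map S S' P
  haveI : IsRegularLocalRing (S' ⧸ P.map (algebraMap S S')) := by
    haveI := hreg'
    exact IsRegularLocalRing.of_ringEquiv (Ideal.quotEquivOfEq heq.symm)
  have hreg : IsRegularLocalRing (S ⧸ P) := IsRegularLocalRing.of_flat_of_isLocalHom (S ⧸ P) (S' ⧸ P.map (algebraMap S S'))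
  exact ⟨P, hP, hreg, hS⟩

/-! ## §4 (c11) for `ε` and for the pair `(ν ; ε)` -/

/-- **(c11) FOR THE LETTER `ε`, ι-half, every dimension**: along a local, formally smooth, essentially-of-finite-type homomorphism
`φ : S → S′` of regular local rings, `iotaEps S′ (φ f) = iotaEps S f` — the permissibility of the equimultiple locus neither appears nor
disappears under essentially smooth base change. [OURS · L1 W4.3, kernel · IOTA3-DESIGN v1 §2.2 (c11ε)] -/
theorem iotaEps_essSmooth_eq (f : S) : iotaEps S' (algebraMap S S' f) = iotaEps S f := by
  have key : IsPermissibleEquimultipleLocus S' (algebraMap S S' f) ↔ IsPermissibleEquimultipleLocus S f :=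
    ⟨isPermissibleEquimultipleLocus_of_map S S' f, isPermissibleEquimultipleLocus_map S S' f⟩
  unfold iotaEps
  rw [show (IsPermissibleEquimultipleLocus S' (algebraMap S S' f) ↔ IsPermissibleEquimultipleLocus S f) from key]

/-- **(c11) FOR THE PAIR `(ν ; ε)`, ι-half, every dimension**: `iotaOrdEps S′ (φ f) = iotaOrdEps S f` (res-type-070's `iotaOrd_essSmooth_eq`
for `ν` and `iotaEps_essSmooth_eq` for `ε`). [OURS · L1 W4.3, kernel] -/
theorem iotaOrdEps_essSmooth_eq (f : S) : iotaOrdEps S' (algebraMap S S' f) = iotaOrdEps S f := by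
  rw [iotaOrdEps_apply, iotaOrdEps_apply, iotaOrd_essSmooth_eq S S' f, iotaEps_essSmooth_eq S S' f]

end EssSmooth

/-- **The ι-half of `IotaJEssSmoothCompatible` for `iotaOrdEps`, in the clause's binder block** (no Krull-dimension bound needed): for every
`J`, the pair `(iotaOrdEps, J)` satisfies (c11) as soon as `J` does its half. [OURS · L1 W4.3, kernel] -/
theorem iotaJEssSmoothCompatible_iotaOrdEps_of (J : (R : Type) → [CommRing R] → R → ℕ → Ideal R)
    (hJ : ∀ (S S' : Type) [CommRing S] [IsRegularLocalRing S] [CommRing S'] [IsRegularLocalRing S'] [Algebra S S']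
      [IsLocalHom (algebraMap S S')] [Algebra.FormallySmooth S S'] [Algebra.EssFiniteType S S'] (f : S),
      ∀ m : ℕ, J S' (algebraMap S S' f) m = (J S f m).map (algebraMap S S')) :
    IotaJEssSmoothCompatible iotaOrdEps J := by
  intro S S' _ _ _ _ _ _ _ _ f
  exact ⟨iotaOrdEps_essSmooth_eq S S' f, hJ S S' f⟩

end Iota3

end Summit.ResolutionOfSingularities.ResolutionOfSingularities.Cruxes.HypersurfaceCentreConstruction.LocalEngine

end
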